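import Mathlib
import Summits.Ventures.HodgeRepro.Tier4.Target
import Summits.Ventures.HodgeRepro.Tier4.Line3.Defs
import Summits.Ventures.HodgeRepro.Tier4.Line3.DefsLemmas
import Summits.Ventures.HodgeRepro.Tier4.Line3.ShrinkMajGauss
import Summits.Ventures.HodgeRepro.Tier4.Line3.IntegralScalarExcess
import Summits.Ventures.HodgeRepro.Tier4.Line3.QuarticProfile
import Summits.Ventures.HodgeRepro.Tier4.Line3.QuarticShapeOfCard
import Summits.Ventures.HodgeRepro.Tier4.Line3.WindowCentre

/-!
# Tier4/Line3/QuarticUnitGap — the unit gap of a quartic CM field is a theorem (Dirichlet), and so is the unit of the window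

Blind re-derivation cell `pub-hodge-repro`, Tier 4 «PROVE THE STEP», LINE L3, seat t4-L3-p2 (g3): the self-cut
C-L3-UNITGAP (STATUS S14492). The quartic ray display (skeleton II-s, v0.49 →) carries `UnitGap η₀` — «a non-zero algebraic
integer of absolute norm `1` that is not norm-one has `‖τ₀ x‖² ≥ η₀` or `≤ 1/η₀`» — as DISPLAYED arithmetic of the field, and
C-L3-WINDOWCENTRE (`Line3.WindowCentre`) asks for a unit `u` with `‖τ₀ u‖² = η₀` and `‖σ u‖² = 1/η₀` at the definite
embeddings. Both are THEOREMS of a quartic CM field, from Mathlib's Dirichlet unit theorem: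

* a quartic CM field is totally complex with two infinite places, so `NumberField.Units.rank E = 1` and the fundamental
  system `fundSystem E` is ONE unit `ε` (`card_infinitePlace_eq_two`, `rank_eq_one`);
* every unit is `ζ · ε^e` with `ζ` torsion (`exist_unique_eq_mul_prod`), and a torsion unit has modulus `1` at every place
  (`mem_torsion`), so `‖τ₀ x‖² = (‖τ₀ ε‖²)^e` (`norm_tau_sq_eq_zpow_fundSystem`);
* `‖τ₀ ε‖² ≠ 1`: otherwise, by the quartic product formula `|N ε| = ‖τ₀ ε‖² ‖σ₁ ε‖²` (x2's `abs_norm_eq_quartic`,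
  `Units.norm`), every embedding of `ε` has modulus `1`, so `ε` is torsion (`mem_torsion`, places = embeddings) and the basis
  `basisModTorsion` would contain `0` (`fundSystem_mk`, `Basis.ne_zero`) — `norm_tau_fundSystem_ne_one`;
* `η₀ := ‖τ₀ ε^{±1}‖² > 1` and `u := ε^{±1}`: `UnitGap η₀` (an algebraic integer of absolute norm `1` is a unit,
  `isUnit_iff_norm`; `c x · x ≠ 1` forces `‖τ₀ x‖² = τ₀(c x · x) ≠ 1`, so the exponent is `≠ 0` and `η₀^e ≥ η₀` or `≤ 1/η₀`),
  and the sizes of `u` at the definite embeddings are `1/η₀` by the product formula (`norm_def_sq_eq_inv`).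

Main statement: `exists_unitGap_unit (h4 : Fintype.card (E →+* ℂ) = 4) : ∃ η₀, 1 < η₀ ∧ UnitGap η₀ ∧ (∀ x unit, ∃ e,
‖τ₀ x‖² = η₀^e) ∧ ∃ u, u ≠ 0 ∧ IsIntegral ℤ u ∧ |N u| = 1 ∧ ‖τ₀ u‖² = η₀ ∧ ∀ σ ∈ defEmb, ‖σ u‖² = 1/η₀`. Composed with
`Line3.WindowCentre` (`exists_unitGap_closed_window_centre`): on a quartic CM field EVERY symmetric `J`-positive centre with
wedge `≠ 0` and `gram 0 1 ≠ 0` has a per-slot unit-power rescaling, with the four clauses, whose slot ratios lie in the closed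
window `[1/η₀, η₀]` at every definite embedding, with `UnitGap η₀` — no displayed unit, no displayed gap.  The OPEN window with the
discriminant clause (the skeleton's `QuarticWindow`) then needs only `η₀² − 6 η₀ + 1 ≤ 0` (field-dependent) and the non-boundary
clause of the centre (`exists_unitScaled_quarticWindow`, WindowCentre).  Nothing here says anything about the status of the Hodge
conjecture for CM abelian varieties, which is NOT proved (HC_CM is NOT proved by anyone in this repository).
-/

set_option autoImplicit false

noncomputable section

namespace Summit.Ventures.HodgeRepro.Tier4.Line3

open Summit.Ventures.HodgeRepro.Tier4
open Matrix NumberField NumberField.InfinitePlace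
open scoped ComplexConjugate
open scoped Classical

namespace T4Data

variable (X : T4Data)

/-! ## A. Two infinite places, unit rank one -/

/-- A quartic CM field has exactly two infinite places (totally complex, `2 · nrComplexPlaces = 4`). -/
theorem card_infinitePlace_eq_two (h4 : Fintype.card (X.E →+* ℂ) = 4) :
    Fintype.card (InfinitePlace X.E) = 2 := by
  have h0 : nrRealPlaces X.E = 0 := nrRealPlaces_eq_zero_iff.2 inferInstance
  have h1 := card_add_two_mul_card_eq_rank (K := X.E)
  rw [← Embeddings.card X.E ℂ, h4, h0] at h1
  rw [card_eq_nrRealPlaces_add_nrComplexPlaces, h0]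
  omega

/-- The unit rank of a quartic CM field is `1`. -/
theorem units_rank_eq_one (h4 : Fintype.card (X.E →+* ℂ) = 4) : NumberField.Units.rank X.E = 1 := by
  unfold NumberField.Units.rank
  rw [X.card_infinitePlace_eq_two h4]

/-- In unit rank one every index of the fundamental system is the given one. -/
theorem fin_rank_eq (h4 : Fintype.card (X.E →+* ℂ) = 4) (i j : Fin (NumberField.Units.rank X.E)) : j = i := by
  have hi := i.2
  have hj := j.2
  have hr := X.units_rank_eq_one h4
  exact Fin.ext (by omega)

/-! ## B. The decomposition `x = ζ · ε^e` and the modulus at `τ₀` -/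

/-- **DIRICHLET IN RANK ONE**: every unit is a torsion unit times a power of the fundamental unit. -/
theorem unit_eq_torsion_mul_zpow (h4 : Fintype.card (X.E →+* ℂ) = 4) (i : Fin (NumberField.Units.rank X.E))
    (x : (𝓞 X.E)ˣ) :
    ∃ (ζ : (𝓞 X.E)ˣ) (e : ℤ), ζ ∈ NumberField.Units.torsion X.E ∧ x = ζ * NumberField.Units.fundSystem X.E i ^ e := by
  obtain ⟨⟨ζ, f⟩, hx, -⟩ := NumberField.Units.exist_unique_eq_mul_prod X.E x
  refine ⟨ζ, f i, ζ.2, ?_⟩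
  rw [hx, Finset.prod_eq_single i (fun j _ hj => absurd (X.fin_rank_eq h4 i j) hj)
    (fun h => absurd (Finset.mem_univ i) h)]

/-- A torsion unit has modulus `1` at `τ₀` (`mem_torsion` at the place of `τ₀`). -/
theorem norm_tau_torsion {ζ : (𝓞 X.E)ˣ} (hζ : ζ ∈ NumberField.Units.torsion X.E) : ‖X.τ₀ (ζ : X.E)‖ = 1 :=
  (NumberField.Units.mem_torsion X.E).1 hζ (InfinitePlace.mk X.τ₀)

/-- The modulus at `τ₀` of a unit power. -/
theorem norm_tau_sq_zpow (x : (𝓞 X.E)ˣ) (n : ℤ) :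
    ‖X.τ₀ ((x ^ n : (𝓞 X.E)ˣ) : X.E)‖ ^ 2 = (‖X.τ₀ (x : X.E)‖ ^ 2) ^ n := by
  rw [NumberField.Units.coe_zpow, map_zpow₀, norm_zpow, ← zpow_natCast, ← zpow_natCast, ← _root_.zpow_mul, ← _root_.zpow_mul,
    mul_comm]

/-- The modulus at `τ₀` of every unit is a power of that of the fundamental unit. -/
theorem norm_tau_sq_eq_zpow_fundSystem (h4 : Fintype.card (X.E →+* ℂ) = 4) (i : Fin (NumberField.Units.rank X.E))
    (x : (𝓞 X.E)ˣ) :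
    ∃ e : ℤ, ‖X.τ₀ (x : X.E)‖ ^ 2 = (‖X.τ₀ (NumberField.Units.fundSystem X.E i : X.E)‖ ^ 2) ^ e := by
  obtain ⟨ζ, e, hζ, hx⟩ := X.unit_eq_torsion_mul_zpow h4 i x
  refine ⟨e, ?_⟩
  rw [hx, NumberField.Units.coe_mul, map_mul, norm_mul, X.norm_tau_torsion hζ, one_mul, X.norm_tau_sq_zpow]

/-! ## C. The product formula for a unit in the quartic shape -/

/-- **THE PRODUCT FORMULA FOR A UNIT**: at every definite embedding `‖σ x‖² = 1/‖τ₀ x‖²` (quartic shape, `|N x| = 1`). -/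
theorem norm_def_sq_eq_inv (hQ : X.QuarticShape) (x : (𝓞 X.E)ˣ) {σ : X.E →+* ℂ} (hσ : σ ∈ X.defEmb) :
    ‖σ (x : X.E)‖ ^ 2 = 1 / ‖X.τ₀ (x : X.E)‖ ^ 2 := by
  obtain ⟨σ₁, hσ₁, hdef⟩ := hQ
  have hN := X.abs_norm_eq_quartic hσ₁ hdef (x : X.E)
  rw [NumberField.Units.norm X.E x, Rat.cast_one] at hN
  have hτ : ‖X.τ₀ (x : X.E)‖ ^ 2 ≠ 0 :=
    pow_ne_zero 2 (norm_ne_zero_iff.2 ((map_ne_zero X.τ₀).2 (NumberField.Units.coe_ne_zero x)))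
  have h1 : ‖σ₁ (x : X.E)‖ ^ 2 = 1 / ‖X.τ₀ (x : X.E)‖ ^ 2 := by
    rw [eq_div_iff hτ, mul_comm]
    exact hN.symm
  rw [hdef, Finset.mem_insert, Finset.mem_singleton] at hσ
  rcases hσ with rfl | rfl
  · exact h1
  · rw [X.norm_conjEmb_apply]
    exact h1

/-- Every complex embedding is `τ₀`, its conjugate, or definite. -/
theorem emb_eq_tau_or_conj_or_def (φ : X.E →+* ℂ) : φ = X.τ₀ ∨ φ = conjEmb X.τ₀ ∨ φ ∈ X.defEmb := by
  by_cases h : φ ∈ X.defEmb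
  · exact Or.inr (Or.inr h)
  · have h' : φ ∈ ({X.τ₀, conjEmb X.τ₀} : Finset (X.E →+* ℂ)) := by
      rw [← X.filter_not_def_eq, Finset.mem_filter]
      refine ⟨Finset.mem_univ _, ?_⟩
      simpa only [defEmb, Finset.mem_filter, Finset.mem_univ, true_and] using h
    rw [Finset.mem_insert, Finset.mem_singleton] at h'
    rcases h' with h' | h'
    · exact Or.inl h'
    · exact Or.inr (Or.inl h')

/-! ## D. The fundamental unit is off the unit circle -/

/-- **THE FUNDAMENTAL UNIT IS NOT TORSION**: by the uniqueness in Dirichlet's decomposition, `ε = ε · ε^0` and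
`ε = 1 · ε^1` would be two decompositions. -/
theorem fundSystem_not_mem_torsion (h4 : Fintype.card (X.E →+* ℂ) = 4) (i : Fin (NumberField.Units.rank X.E)) :
    NumberField.Units.fundSystem X.E i ∉ NumberField.Units.torsion X.E := by
  intro htor
  obtain ⟨ζe, -, huniq⟩ :=
    NumberField.Units.exist_unique_eq_mul_prod X.E (NumberField.Units.fundSystem X.E i)
  have h1 : (⟨⟨NumberField.Units.fundSystem X.E i, htor⟩, 0⟩ :
      NumberField.Units.torsion X.E × (Fin (NumberField.Units.rank X.E) → ℤ)) = ζe :=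
    huniq _ (by simp)
  have h2 : (⟨1, fun _ => 1⟩ :
      NumberField.Units.torsion X.E × (Fin (NumberField.Units.rank X.E) → ℤ)) = ζe :=
    huniq _ (by
      beta_reduce
      rw [Finset.prod_eq_single i (fun j _ hj => absurd (X.fin_rank_eq h4 i j) hj)
        (fun h => absurd (Finset.mem_univ i) h)]
      simp)
  have h3 := congrArg (fun p : NumberField.Units.torsion X.E × (Fin (NumberField.Units.rank X.E) → ℤ) => p.2 i)
    (h1.trans h2.symm)
  simp at h3

/-- **THE FUNDAMENTAL UNIT IS NOT OF MODULUS `1` AT `τ₀`**: otherwise every embedding has modulus `1` (product formula),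
the unit is torsion, and `basisModTorsion` would contain `0`. -/
theorem norm_tau_fundSystem_ne_one (h4 : Fintype.card (X.E →+* ℂ) = 4) (i : Fin (NumberField.Units.rank X.E)) :
    ‖X.τ₀ (NumberField.Units.fundSystem X.E i : X.E)‖ ≠ 1 := by
  intro h1
  have hQ := X.quarticShape_of_card h4
  set ε := NumberField.Units.fundSystem X.E i with hε
  have hall : ∀ φ : X.E →+* ℂ, ‖φ (ε : X.E)‖ = 1 := by
    intro φ
    rcases X.emb_eq_tau_or_conj_or_def φ with rfl | rfl | hφ
    · exact h1
    · rw [X.norm_conjEmb_apply]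
      exact h1
    · have h2 := X.norm_def_sq_eq_inv hQ ε hφ
      rw [h1, one_pow, div_one] at h2
      exact (pow_eq_one_iff_of_nonneg (norm_nonneg _) (by norm_num)).1 h2
  have htor : ε ∈ NumberField.Units.torsion X.E := by
    rw [NumberField.Units.mem_torsion X.E]
    intro w
    rw [← mk_embedding w, InfinitePlace.apply]
    exact hall _
  exact X.fundSystem_not_mem_torsion h4 i htor

/-! ## E. The unit gap and the unit of the window -/

/-- `‖τ₀ x‖² = τ₀ (c x · x)` as a complex number. -/
theorem emb_tau_c_mul (x : X.E) : X.τ₀ (X.c x * x) = ((‖X.τ₀ x‖ ^ 2 : ℝ) : ℂ) := by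
  rw [map_mul, X.conj_emb_c, Complex.conj_mul', Complex.ofReal_pow]

/-- `c x · x ≠ 1` forces `‖τ₀ x‖² ≠ 1`. -/
theorem norm_tau_sq_ne_one_of_c_mul_ne_one {x : X.E} (hc : X.c x * x ≠ 1) : ‖X.τ₀ x‖ ^ 2 ≠ 1 := by
  intro h
  apply hc
  apply X.τ₀.injective
  rw [X.emb_tau_c_mul, h, map_one, Complex.ofReal_one]

/-- An algebraic integer of absolute norm `1` is (the image of) a unit of `𝓞 E` (`isUnit_iff_norm`). -/
theorem exists_unit_of_abs_norm_eq_one {x : X.E} (hx : IsIntegral ℤ x) (hN : |Algebra.norm ℚ x| = 1) :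
    ∃ xu : (𝓞 X.E)ˣ, (xu : X.E) = x := by
  let y : 𝓞 X.E := ⟨x, hx⟩
  have hy : (y : X.E) = x := rfl
  have hyu : IsUnit y := by
    rw [NumberField.isUnit_iff_norm, RingOfIntegers.coe_norm, hy]
    exact hN
  obtain ⟨xu, hxu⟩ := hyu
  refine ⟨xu, ?_⟩
  rw [← NumberField.Units.coe_coe, hxu]
  exact hy

/-- **THE UNIT GAP AND THE UNIT ARE THEOREMS OF A QUARTIC CM FIELD** (Dirichlet): there is `η₀ > 1` with `UnitGap η₀`,
every unit has `‖τ₀ x‖² = η₀^e`, and there is an algebraic-integer unit `u` with `‖τ₀ u‖² = η₀` and `‖σ u‖² = 1/η₀` at every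
definite embedding — the unit datum of `Line3.WindowCentre`. -/
theorem exists_unitGap_unit (h4 : Fintype.card (X.E →+* ℂ) = 4) :
    ∃ η₀ : ℝ, 1 < η₀ ∧ X.UnitGap η₀ ∧
      (∀ x : (𝓞 X.E)ˣ, ∃ e : ℤ, ‖X.τ₀ (x : X.E)‖ ^ 2 = η₀ ^ e) ∧
      ∃ u : X.E, u ≠ 0 ∧ IsIntegral ℤ u ∧ |Algebra.norm ℚ u| = 1 ∧ ‖X.τ₀ u‖ ^ 2 = η₀ ∧
        ∀ σ ∈ X.defEmb, ‖σ u‖ ^ 2 = 1 / η₀ := by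
  have hQ := X.quarticShape_of_card h4
  let i : Fin (NumberField.Units.rank X.E) := ⟨0, by rw [X.units_rank_eq_one h4]; exact Nat.zero_lt_one⟩
  -- a unit `v` of modulus `> 1` at `τ₀` whose powers carry every unit's modulus: `ε` or `ε⁻¹`
  obtain ⟨v, hv1, hvpow⟩ : ∃ v : (𝓞 X.E)ˣ, 1 < ‖X.τ₀ (v : X.E)‖ ^ 2 ∧
      ∀ x : (𝓞 X.E)ˣ, ∃ e : ℤ, ‖X.τ₀ (x : X.E)‖ ^ 2 = (‖X.τ₀ (v : X.E)‖ ^ 2) ^ e := by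
    set ε := NumberField.Units.fundSystem X.E i with hε
    have hne : ‖X.τ₀ (ε : X.E)‖ ≠ 1 := X.norm_tau_fundSystem_ne_one h4 i
    have hpos : 0 < ‖X.τ₀ (ε : X.E)‖ :=
      norm_pos_iff.2 ((map_ne_zero X.τ₀).2 (NumberField.Units.coe_ne_zero ε))
    rcases lt_or_gt_of_ne hne with hlt | hgt
    · refine ⟨ε ^ (-1 : ℤ), ?_, fun x => ?_⟩
      · rw [X.norm_tau_sq_zpow, _root_.zpow_neg_one, one_lt_inv₀ (by positivity)]
        nlinarith
      · obtain ⟨e, he⟩ := X.norm_tau_sq_eq_zpow_fundSystem h4 i x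
        refine ⟨-e, ?_⟩
        rw [he, X.norm_tau_sq_zpow, ← _root_.zpow_mul]
        congr 1
        ring
    · refine ⟨ε, ?_, fun x => X.norm_tau_sq_eq_zpow_fundSystem h4 i x⟩
      nlinarith
  refine ⟨‖X.τ₀ (v : X.E)‖ ^ 2, hv1, ?_, hvpow, (v : X.E), NumberField.Units.coe_ne_zero v,
    NumberField.RingOfIntegers.isIntegral_coe (v : 𝓞 X.E), NumberField.Units.norm X.E v, rfl,
    fun σ hσ => X.norm_def_sq_eq_inv hQ v hσ⟩
  -- the unit gap
  intro x hx hx0 hN hc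
  obtain ⟨xu, hxE⟩ := X.exists_unit_of_abs_norm_eq_one hx hN
  obtain ⟨e, he⟩ := hvpow xu
  rw [hxE] at he
  have hne1 : ‖X.τ₀ x‖ ^ 2 ≠ 1 := X.norm_tau_sq_ne_one_of_c_mul_ne_one hc
  have he0 : e ≠ 0 := by
    rintro rfl
    rw [zpow_zero] at he
    exact hne1 he
  have hv1' : 1 ≤ ‖X.τ₀ (v : X.E)‖ ^ 2 := hv1.le
  rcases lt_or_gt_of_ne he0 with hneg | hpos
  · right
    rw [he, one_div, ← _root_.zpow_neg_one]
    exact zpow_le_zpow_right₀ hv1' (by omega)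
  · left
    rw [he]
    calc ‖X.τ₀ (v : X.E)‖ ^ 2 = (‖X.τ₀ (v : X.E)‖ ^ 2) ^ (1 : ℤ) := (zpow_one _).symm
      _ ≤ (‖X.τ₀ (v : X.E)‖ ^ 2) ^ e := zpow_le_zpow_right₀ hv1' (by omega)

/-! ## F. With `WindowCentre`: the closed quartic window is reachable from every centre — unit-free, gap-free -/

/-- **THE CLOSED QUARTIC WINDOW IS REACHABLE FROM EVERY CENTRE** on a quartic CM field, with the unit gap: for every
symmetric `J`-positive centre `xm` with wedge `≠ 0` and `gram 0 1 ≠ 0` there are `η₀ > 1` with `UnitGap η₀`, an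
algebraic-integer unit `u` with `‖τ₀ u‖² = η₀`, `‖σ u‖² = 1/η₀` (`σ ∈ defEmb`), and the centre `xm' j = u^(k j) • xm j`
(`k 2 = k 0`, `k 3 = k 1`) with the four clauses and every slot ratio in `[1/η₀, η₀]` at every definite embedding
(`exists_unitGap_unit` + `exists_unitScaled_closed_window_quartic`). -/
theorem exists_unitGap_closed_window_centre (h4 : Fintype.card (X.E →+* ℂ) = 4)
    {xm : X.Tuple} (h02 : xm 2 = xm 0) (h13 : xm 3 = xm 1)
    (hab : X.ballCoord (xm 0) 0 * X.ballCoord (xm 1) 1 - X.ballCoord (xm 0) 1 * X.ballCoord (xm 1) 0 ≠ 0)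
    (hpos : ∀ u v : ℂ, (u ≠ 0 ∨ v ≠ 0) →
      0 < (star (u • X.ballCoord (xm 0) + v • X.ballCoord (xm 1)) ⬝ᵥ
        (J *ᵥ (u • X.ballCoord (xm 0) + v • X.ballCoord (xm 1)))).re)
    (hB : X.gram xm 0 1 ≠ 0) :
    ∃ η₀ : ℝ, 1 < η₀ ∧ X.UnitGap η₀ ∧
      ∃ (u : X.E) (xm' : X.Tuple), u ≠ 0 ∧ IsIntegral ℤ u ∧ |Algebra.norm ℚ u| = 1 ∧ ‖X.τ₀ u‖ ^ 2 = η₀ ∧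
        (∀ σ ∈ X.defEmb, ‖σ u‖ ^ 2 = 1 / η₀) ∧
        (∃ k : Fin 4 → ℤ, k 2 = k 0 ∧ k 3 = k 1 ∧ ∀ j, xm' j = u ^ (k j) • xm j) ∧
        xm' 2 = xm' 0 ∧ xm' 3 = xm' 1 ∧
        X.ballCoord (xm' 0) 0 * X.ballCoord (xm' 1) 1 - X.ballCoord (xm' 0) 1 * X.ballCoord (xm' 1) 0 ≠ 0 ∧
        (∀ u v : ℂ, (u ≠ 0 ∨ v ≠ 0) →
          0 < (star (u • X.ballCoord (xm' 0) + v • X.ballCoord (xm' 1)) ⬝ᵥ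
            (J *ᵥ (u • X.ballCoord (xm' 0) + v • X.ballCoord (xm' 1)))).re) ∧
        X.gram xm' 0 1 ≠ 0 ∧
        ∀ j, ∀ σ ∈ X.defEmb, 1 / η₀ ≤ 2 * X.defQuad σ (xm' j) / X.tauSize (xm' j) ∧
          2 * X.defQuad σ (xm' j) / X.tauSize (xm' j) ≤ η₀ := by
  obtain ⟨η₀, hη, hgap, -, u, hu0, hint, hN, hu1, hu2⟩ := X.exists_unitGap_unit h4
  obtain ⟨xm', hk, h02', h13', hab', hpos', hB', hwin⟩ :=
    X.exists_unitScaled_closed_window_quartic (X.quarticShape_of_card h4) hu0 hη hu1 hu2 h02 h13 hab hpos hB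
  exact ⟨η₀, hη, hgap, u, xm', hu0, hint, hN, hu1, hu2, hk, h02', h13', hab', hpos', hB', hwin⟩

end T4Data

end Summit.Ventures.HodgeRepro.Tier4.Line3

end
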